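import Summits.BirchSwinnertonDyer.BirchSwinnertonDyer.Theorems.KatoDescentPotSupersingularWildJetchevBoundAtPTwoSplit
import HarnessLib

/-!
# Route `KatoDescentPotSupersingular` (rung K9, wild `3`, cell `bsd-potss`): the split child `WildJetchevBoundAtPTwoNonsplit` (item 21423,
# crux 19941 at Heegner fields in which `2` does NOT split) — how far the four named facts reach, and the EXACT open slice

Cell `bsd-potss`, seat `bsd-potss-k9-c4` g11 (prover); `--supports stmt-BirchSwinnertonDyer-21423`, helper (imports the K9 route file through
`…WildJetchevBoundAtPTwoSplit`). CONDITIONAL on the four named Literature facts {Matar–Nekovář 2019 Thm 0.7, Gross 1991 Prop 3.7 (2), Poitou–Tate,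
[GZ86 III (3.1)] image-free} + the route's held `PublishedInputsHeegner`; closes NOTHING; BSD is not proved for any curve.

WHAT. Item 21423's body is 19941's with `¬ SatisfiesHeegnerHypothesis 2 K` (2 inert or ramified in `K`). This seat's row theorem
`JetchevIrreducibleSwapAtP.boundAtP_of_structureIrred_of_namedFacts_of_twoGuard` (p564034) gives the bound on every row with `d_K ≠ −4` under the
ONE row condition «`2` Zhang–Kolyvagin for `(E, K, p)` at level `N_E` ⇒ `ρ̄_{E,p}` onto». Hence (all below, the crux body with the displayed
extra binders, from the four facts + `PublishedInputsHeegner`):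
* `wildJetchevBoundAtPTwoNonsplit_of_namedFacts_of_guard` — extra binders `NumberField.discr K ≠ -4` and the row condition;
* `…_of_surjective` — the rows with `ρ̄_{E,p}` ONTO (onto mod `p`, not mod `p²`: the 9-deficient rows), every non-split `K` with `d_K ≠ −4`;
* `…_of_even_conductor` — the rows with `2 ∣ N` (a Kolyvagin prime does not divide the level), every non-split `K` with `d_K ≠ −4`.
So the OPEN SLICE of 21423 is exactly: `d_K = −4` (the former Gaussian supplement: S1 is printed for `D_K ≠ −3, −4`) ∪ «`2 ∤ N` ∧ `2` inert in
`K` ∧ `3 ∣ a₂(E)` ∧ `ρ̄_{E,3}` irreducible not onto» (p = 3 forced by `eq_three_of_isKolyvaginPrime_two`; census: 10 of the 344 U₀-ns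
Nn/Ns rows below conductor 500 000 — FINDING memo §3b). Neither sub-slice is used by the J08 road (2-split BFH field).

References (locators only; cited FACTS enter as hypotheses, never declared): [cite: Jetchev2008, Cor. 1.5 (p. 812)]
[cite: MatarNekovar2019, Thm. 0.7 (p. 456), §0.11] [cite: GrossLMS1991, §3 (3.1)–(3.3), Prop. 3.7 (2)] [cite: GrossZagier1986, III (3.1)]
[cite: MilneADT2006, Ch. I, Thm. 4.10] [cite: WZhang2014, Notations (xii)]. Design: theorems only. Axioms: `propext`, `Classical.choice`, `Quot.sound`.
-/

set_option autoImplicit false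
-- the Theorems directory repeats the summit name (sibling precedent `KatoDescentPotSupersingularAssembly.lean`)
set_option linter.dupNamespace false

noncomputable section

open scoped Classical

open WeierstrassCurve Literature.NumberTheory.EllipticCurves Literature.NumberTheory.EllipticCurves.ModularForms
  Literature.NumberTheory.EllipticCurves.Rank1Residual Literature.NumberTheory.GaloisCohomology
  Summit.BirchSwinnertonDyer.BirchSwinnertonDyer.Theses.KatoDescentPotSupersingular

namespace Summit.BirchSwinnertonDyer.BirchSwinnertonDyer.Theorems.JetchevIrreducibleSwapAtP

/-- **21423's body with two extra binders** — `NumberField.discr K ≠ -4` and the row condition «`2` Zhang–Kolyvagin for `(E, K, p)` at level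
`N_E` ⇒ `ρ̄_{E,p}` onto» — from the four named facts + `PublishedInputsHeegner` (the binder `¬ SatisfiesHeegnerHypothesis 2 K` is not used).
CONDITIONAL; closes NOTHING. [cite: Jetchev2008, Cor. 1.5 (p. 812)] [cite: MatarNekovar2019, Thm. 0.7] [cite: GrossLMS1991, Prop. 3.7 (2)] -/
theorem wildJetchevBoundAtPTwoNonsplit_of_namedFacts_of_guard
    (hS1 : MatarNekovar2019.thm07_padicValNat_card_sha_primary_add_le_of_globalDivisibility_of_irreducible)
    (h37 : GrossLMS1991.prop37_2_frobeniusCongruence)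
    (hPT : ∀ (K : Type) [Field K] [NumberField K], poitouTate_selmerStructure_duality_conj K)
    (hF1 : Gross1991_heegnerPoint_sub_ratTorsion_mem_E0_imageFree)
    (hH : PublishedInputsHeegner) :
    ∀ (N : ℕ) [NeZero N] (W : WeierstrassCurve ℚ) [W.IsElliptic] [W.IsGloballyMinimal]
      (K : Type) [Field K] [NumberField K],
      IsImaginaryQuadratic K → NumberField.discr K ≠ -3 → SatisfiesHeegnerHypothesis N K →
      ¬ SatisfiesHeegnerHypothesis 2 K → NumberField.discr K ≠ -4 →
      ∀ (p : ℕ) [Fact p.Prime], p ≠ 2 → W.analyticRank = 0 → Addv W p → 0 ≤ padicValRat p W.j →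
      ¬ W.HasCM → W.HasIrreducibleModPGaloisRep p → ¬ (∀ n : ℕ, W.HasSurjectiveModNGaloisRep (p ^ n : ℕ)) →
      (∃ Dt : ModularParametrizationData W N,
        (∀ z ∈ Dt.L.lattice, ∃ w ∈ periodLattice Dt.f, z = (Dt.c : ℂ) * w) ∧ ¬ (p : ℤ) ∣ Dt.c) →
      (Zhang2014.IsKolyvaginPrime (W.conductorNorm ℤ) W K p 2 → W.HasSurjectiveModNGaloisRep p) →
      ∀ {P : (W.baseChange K).toAffine.Point}, IsHeegnerPoint N W K P → ¬ IsOfFinAddOrder P → p ∣ N →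
      padicValNat p (Nat.card (AddCommGroup.primaryComponent (W.baseChange K).sha p)) +
          2 * padicValNat p ((W.baseChange ℚ_[p]).localTamagawaNumber ℤ_[p]) ≤
        2 * padicValNat p (AddSubgroup.zmultiples P).index := by
  intro N _ W _ _ K _ _ hK hD3 hHN _ hD4 p _ hp2 hr hadd hj hcm hirr hns hopt hR P hP hnt _
  exact boundAtP_of_structureIrred_of_namedFacts_of_twoGuard hS1 h37 hPT hF1 hH.2.1 hH.2.2.2.1 N W K hK hD3 hD4 hHN p hp2 hr hadd
    hj hcm hirr hns hopt hR hP hnt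

/-- **21423's body on the rows with `ρ̄_{E,p}` ONTO** (the 9-deficient rows), every non-split Heegner field with `d_K ≠ −4`, from the four named
facts + `PublishedInputsHeegner` (the typed Gross 3.7 (2) fact's second disjunct covers the Kolyvagin prime `2`). CONDITIONAL; closes NOTHING.
[cite: GrossLMS1991, §2, Prop. 3.7 (2)] [cite: Jetchev2008, Cor. 1.5 (p. 812)] -/
theorem wildJetchevBoundAtPTwoNonsplit_of_namedFacts_of_surjective
    (hS1 : MatarNekovar2019.thm07_padicValNat_card_sha_primary_add_le_of_globalDivisibility_of_irreducible)
    (h37 : GrossLMS1991.prop37_2_frobeniusCongruence)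
    (hPT : ∀ (K : Type) [Field K] [NumberField K], poitouTate_selmerStructure_duality_conj K)
    (hF1 : Gross1991_heegnerPoint_sub_ratTorsion_mem_E0_imageFree)
    (hH : PublishedInputsHeegner) :
    ∀ (N : ℕ) [NeZero N] (W : WeierstrassCurve ℚ) [W.IsElliptic] [W.IsGloballyMinimal]
      (K : Type) [Field K] [NumberField K],
      IsImaginaryQuadratic K → NumberField.discr K ≠ -3 → SatisfiesHeegnerHypothesis N K →
      ¬ SatisfiesHeegnerHypothesis 2 K → NumberField.discr K ≠ -4 →
      ∀ (p : ℕ) [Fact p.Prime], p ≠ 2 → W.analyticRank = 0 → Addv W p → 0 ≤ padicValRat p W.j →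
      ¬ W.HasCM → W.HasIrreducibleModPGaloisRep p → W.HasSurjectiveModNGaloisRep p →
      ¬ (∀ n : ℕ, W.HasSurjectiveModNGaloisRep (p ^ n : ℕ)) →
      (∃ Dt : ModularParametrizationData W N,
        (∀ z ∈ Dt.L.lattice, ∃ w ∈ periodLattice Dt.f, z = (Dt.c : ℂ) * w) ∧ ¬ (p : ℤ) ∣ Dt.c) →
      ∀ {P : (W.baseChange K).toAffine.Point}, IsHeegnerPoint N W K P → ¬ IsOfFinAddOrder P → p ∣ N →
      padicValNat p (Nat.card (AddCommGroup.primaryComponent (W.baseChange K).sha p)) +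
          2 * padicValNat p ((W.baseChange ℚ_[p]).localTamagawaNumber ℤ_[p]) ≤
        2 * padicValNat p (AddSubgroup.zmultiples P).index := by
  intro N _ W _ _ K _ _ hK hD3 hHN h2 hD4 p _ hp2 hr hadd hj hcm hirr hsurj hns hopt P hP hnt hpN
  exact wildJetchevBoundAtPTwoNonsplit_of_namedFacts_of_guard hS1 h37 hPT hF1 hH N W K hK hD3 hHN h2 hD4 p hp2 hr hadd hj hcm hirr hns
    hopt (fun _ ↦ hsurj) hP hnt hpN

/-- **21423's body on the rows with `2 ∣ N`** (a Zhang–Kolyvagin prime does not divide the level, so `2` is not one), every non-split Heegner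
field with `d_K ≠ −4`, from the four named facts + `PublishedInputsHeegner`. CONDITIONAL; closes NOTHING. [cite: WZhang2014, Notations (xii)]
[cite: Jetchev2008, Cor. 1.5 (p. 812)] -/
theorem wildJetchevBoundAtPTwoNonsplit_of_namedFacts_of_even_conductor
    (hS1 : MatarNekovar2019.thm07_padicValNat_card_sha_primary_add_le_of_globalDivisibility_of_irreducible)
    (h37 : GrossLMS1991.prop37_2_frobeniusCongruence)
    (hPT : ∀ (K : Type) [Field K] [NumberField K], poitouTate_selmerStructure_duality_conj K)
    (hF1 : Gross1991_heegnerPoint_sub_ratTorsion_mem_E0_imageFree)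
    (hH : PublishedInputsHeegner) :
    ∀ (N : ℕ) [NeZero N] (W : WeierstrassCurve ℚ) [W.IsElliptic] [W.IsGloballyMinimal]
      (K : Type) [Field K] [NumberField K],
      IsImaginaryQuadratic K → NumberField.discr K ≠ -3 → SatisfiesHeegnerHypothesis N K →
      ¬ SatisfiesHeegnerHypothesis 2 K → NumberField.discr K ≠ -4 →
      ∀ (p : ℕ) [Fact p.Prime], p ≠ 2 → W.analyticRank = 0 → Addv W p → 0 ≤ padicValRat p W.j →
      ¬ W.HasCM → W.HasIrreducibleModPGaloisRep p → ¬ (∀ n : ℕ, W.HasSurjectiveModNGaloisRep (p ^ n : ℕ)) →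
      (∃ Dt : ModularParametrizationData W N,
        (∀ z ∈ Dt.L.lattice, ∃ w ∈ periodLattice Dt.f, z = (Dt.c : ℂ) * w) ∧ ¬ (p : ℤ) ∣ Dt.c) →
      2 ∣ W.conductorNorm ℤ →
      ∀ {P : (W.baseChange K).toAffine.Point}, IsHeegnerPoint N W K P → ¬ IsOfFinAddOrder P → p ∣ N →
      padicValNat p (Nat.card (AddCommGroup.primaryComponent (W.baseChange K).sha p)) +
          2 * padicValNat p ((W.baseChange ℚ_[p]).localTamagawaNumber ℤ_[p]) ≤
        2 * padicValNat p (AddSubgroup.zmultiples P).index := by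
  intro N _ W _ _ K _ _ hK hD3 hHN h2 hD4 p _ hp2 hr hadd hj hcm hirr hns hopt h2N P hP hnt hpN
  exact wildJetchevBoundAtPTwoNonsplit_of_namedFacts_of_guard hS1 h37 hPT hF1 hH N W K hK hD3 hHN h2 hD4 p hp2 hr hadd hj hcm hirr hns
    hopt (fun hKol ↦ absurd h2N hKol.2.1) hP hnt hpN

/-! ## §2 For `p ≡ 3 (mod 4)` — in particular the K9 prime `p = 3` — the binder `d_K ≠ −4` is automatic -/

/-- For an odd prime `p ≡ 3 (mod 4)`: `(−4 / p) = −1` (`(−1/p) = χ₄(p) = −1`, `(4/p) = 1`). [folklore] -/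
theorem jacobiSym_neg_four_of_mod_four_eq_three {p : ℕ} (hp : p.Prime) (h4 : p % 4 = 3) : jacobiSym (-4) p = -1 := by
  have hodd : Odd p := hp.odd_of_ne_two (by omega)
  have hg : Int.gcd 2 p = 1 := by
    have h : Nat.Coprime 2 p := Nat.coprime_two_left.mpr hodd
    exact_mod_cast (show Int.gcd ((2 : ℕ) : ℤ) (p : ℤ) = 1 by rw [Int.gcd_natCast_natCast]; exact h)
  have h4' : jacobiSym 4 p = 1 := by
    rw [show (4 : ℤ) = 2 ^ 2 by norm_num]; exact jacobiSym.sq_one' hg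
  rw [show (-4 : ℤ) = -1 * 4 by norm_num, jacobiSym.mul_left, jacobiSym.at_neg_one hodd,
    ZMod.χ₄_nat_three_mod_four h4, h4']
  norm_num

/-- **Under the Heegner hypothesis for a level divisible by a prime `p ≡ 3 (mod 4)`, `d_K ≠ −4`**: `p` splits in `K`, so `(d_K / p) = 1`
(`Literature.SatisfiesHeegnerHypothesis.jacobiSym_discr_eq_one`), whereas `(−4 / p) = −1`. In particular on every K9 row (`p = 3 ∣ N`) the
Gaussian field is not a Heegner field. [folklore] -/
theorem discr_ne_neg_four_of_heegnerHypothesis_of_dvd_of_mod_four_eq_three {K : Type} [Field K] [NumberField K]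
    (hK : IsImaginaryQuadratic K) {N : ℕ} (hH : SatisfiesHeegnerHypothesis N K) {p : ℕ} (hp : p.Prime) (hpN : p ∣ N)
    (h4 : p % 4 = 3) : NumberField.discr K ≠ -4 := by
  intro hd
  have hj := Literature.SatisfiesHeegnerHypothesis.jacobiSym_discr_eq_one hK.1 hH hp hpN (by omega)
  rw [hd, jacobiSym_neg_four_of_mod_four_eq_three hp h4] at hj
  norm_num at hj

/-- **21423's body for `p ≡ 3 (mod 4)` (so for K9's `p = 3`) with ONE extra binder** — the row condition «`2` Zhang–Kolyvagin for
`(E, K, p)` at level `N_E` ⇒ `ρ̄_{E,p}` onto» — from the four named facts + `PublishedInputsHeegner`; the binder `d_K ≠ −4` of §1 is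
discharged by `p ∣ N` (the crux's own last binder) and `p ≡ 3 (mod 4)`. So at `p = 3` the open slice of 21423 is EXACTLY «`2 ∤ N` ∧ `2`
inert in `K` ∧ `3 ∣ a₂(E)` ∧ `ρ̄_{E,3}` not onto». CONDITIONAL; closes NOTHING. [cite: Jetchev2008, Cor. 1.5 (p. 812)]
[cite: MatarNekovar2019, Thm. 0.7] [cite: GrossLMS1991, §3 (3.3), Prop. 3.7 (2)] -/
theorem wildJetchevBoundAtPTwoNonsplit_of_namedFacts_of_guard_of_mod_four_eq_three
    (hS1 : MatarNekovar2019.thm07_padicValNat_card_sha_primary_add_le_of_globalDivisibility_of_irreducible)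
    (h37 : GrossLMS1991.prop37_2_frobeniusCongruence)
    (hPT : ∀ (K : Type) [Field K] [NumberField K], poitouTate_selmerStructure_duality_conj K)
    (hF1 : Gross1991_heegnerPoint_sub_ratTorsion_mem_E0_imageFree)
    (hH : PublishedInputsHeegner) :
    ∀ (N : ℕ) [NeZero N] (W : WeierstrassCurve ℚ) [W.IsElliptic] [W.IsGloballyMinimal]
      (K : Type) [Field K] [NumberField K],
      IsImaginaryQuadratic K → NumberField.discr K ≠ -3 → SatisfiesHeegnerHypothesis N K →
      ¬ SatisfiesHeegnerHypothesis 2 K →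
      ∀ (p : ℕ) [Fact p.Prime], p ≠ 2 → p % 4 = 3 → W.analyticRank = 0 → Addv W p → 0 ≤ padicValRat p W.j →
      ¬ W.HasCM → W.HasIrreducibleModPGaloisRep p → ¬ (∀ n : ℕ, W.HasSurjectiveModNGaloisRep (p ^ n : ℕ)) →
      (∃ Dt : ModularParametrizationData W N,
        (∀ z ∈ Dt.L.lattice, ∃ w ∈ periodLattice Dt.f, z = (Dt.c : ℂ) * w) ∧ ¬ (p : ℤ) ∣ Dt.c) →
      (Zhang2014.IsKolyvaginPrime (W.conductorNorm ℤ) W K p 2 → W.HasSurjectiveModNGaloisRep p) →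
      ∀ {P : (W.baseChange K).toAffine.Point}, IsHeegnerPoint N W K P → ¬ IsOfFinAddOrder P → p ∣ N →
      padicValNat p (Nat.card (AddCommGroup.primaryComponent (W.baseChange K).sha p)) +
          2 * padicValNat p ((W.baseChange ℚ_[p]).localTamagawaNumber ℤ_[p]) ≤
        2 * padicValNat p (AddSubgroup.zmultiples P).index := by
  intro N _ W _ _ K _ _ hK hD3 hHN h2 p _ hp2 h4 hr hadd hj hcm hirr hns hopt hR P hP hnt hpN
  exact wildJetchevBoundAtPTwoNonsplit_of_namedFacts_of_guard hS1 h37 hPT hF1 hH N W K hK hD3 hHN h2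
    (discr_ne_neg_four_of_heegnerHypothesis_of_dvd_of_mod_four_eq_three hK hHN (Fact.out : p.Prime) hpN h4) p hp2 hr hadd hj hcm hirr
    hns hopt hR hP hnt hpN

end Summit.BirchSwinnertonDyer.BirchSwinnertonDyer.Theorems.JetchevIrreducibleSwapAtP

end
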